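import Mathlib.Analysis.Complex.Schwarz
import Mathlib.Analysis.Normed.Field.Lemmas
import Mathlib.Analysis.Normed.Group.Bounded
import Mathlib.Topology.Compactness.LocallyCompact
import Literature.Probability.RandomPlanarGeometry.CaratheodoryHalfPlane
import HarnessLib

/-!
# Automorphisms of the half-plane and uniqueness of chordal uniformizing maps (trunk `Stoch`)

This file proves the named fact
`Literature.Probability.RandomPlanarGeometry.MarkedDomain.IsChordalUniformizing.exists_eq_trans_smul` (and, with the same tools, the
named facts `Literature.Probability.RandomPlanarGeometry.JordanDomain.existsUnique_real_or_infty` and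
`Literature.Probability.RandomPlanarGeometry.ConformalRectangle.crossRatio_eq_of_isUniformizing`) of
`Literature.Probability.RandomPlanarGeometry.ConformalRectangle` (two chordal uniformizing maps
`φ, φ' : (ℍₒ; 0, ∞) → (D; a, b)` of the same Dobrushin domain differ by a dilation `z ↦ c z`,
`c > 0`; Lawler (2005), §6.1, "any other such `F̂` can be written as `r F` for some `r > 0`")
from the printed disc form of Carathéodory's theorem
(`Literature.Probability.RandomPlanarGeometry.JordanDomain.exists_continuousOn_extension`, Pommerenke (1992), Thm. 2.6), which stays the
only literature input (`exists_eq_trans_smul_of_disc`). On the way: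

* `Literature.Probability.RandomPlanarGeometry.ConformalEquiv.exists_eqOn_mul_of_apply_zero`: a conformal automorphism of the unit disc
  fixing `0` is a rotation `z ↦ u z`, `|u| = 1` (Schwarz's lemma applied to `f` and `f⁻¹`, and
  Mathlib's equality case `Complex.affine_of_mapsTo_ball_of_norm_dslope_eq_div`);
* `Literature.Probability.RandomPlanarGeometry.ConformalEquiv.exists_eqOn_normalForm`: every conformal automorphism `M` of `ℍₒ` is
  `z ↦ q · C⁻¹(u · C z) + p` on `ℍₒ` with `q > 0`, `p ∈ ℝ`, `|u| = 1`, `C` the Cayley transform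
  (normalise `M i = p + q i` by the real affine automorphism `z ↦ q z + p`, i.e.
  `(smulUpperHalfPlane q).trans (addRealUpperHalfPlane p)` of `ConformalMap` /
  `CaratheodoryHalfPlane`, conjugate to the disc, apply the previous item);
* `Literature.Probability.RandomPlanarGeometry.ConformalEquiv.exists_eqOn_smul_of_tendsto`: if moreover `M z → 0` as `z → 0` and
  `M z → ∞` as `z → ∞` (within `ℍₒ`), then `M z = c z` on `ℍₒ` for some `c > 0`;
* `Literature.Probability.RandomPlanarGeometry.JordanDomain.tendsto_cayleyFun_symm`: under a Carathéodory extension `Ψ` of `φ ∘ C⁻¹` to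
  the closed disc, `C (φ⁻¹ w) → ζ` as `w → Ψ ζ` within `D` (compactness of the closed disc and
  injectivity of `Ψ`; no continuity of `Ψ⁻¹` is assumed), whence the boundary behaviour
  `φ⁻¹ ∘ φ' → 0` at `0` and `→ ∞` at `∞` for two chordal uniformizing maps;
* `Literature.Probability.RandomPlanarGeometry.JordanDomain.existsUnique_real_or_infty_of_disc`: the half-plane boundary correspondence
  (`JordanDomain.existsUnique_real_or_infty` of `ConformalMap`: every `p ∈ ∂D` is the boundary
  value of `φ` at infinity or at exactly one real point), again from the disc form.
* `Literature.Probability.RandomPlanarGeometry.ConformalRectangle.crossRatio_eq_of_isUniformizing_of_disc`: conformal invariance of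
  Cardy's cross-ratio (`ConformalRectangle.crossRatio_eq_of_isUniformizing` of
  `ConformalRectangle`: two uniformizing data of a conformal rectangle have the same cross-ratio),
  from the disc form: `φ⁻¹ ∘ φ'` is a real Möbius map carrying `x'` to `x`
  (`ConformalEquiv.normalForm_boundaryValue`, `cayleyInvFun_mul_cayleyFun`), and Möbius maps
  preserve the (complex) cross-ratio (`Literature.Probability.RandomPlanarGeometry.cCrossRatio`, `cCrossRatio_moebius`).

## Mathlib

We USE `Complex.norm_le_norm_of_mapsTo_ball` (Schwarz) and
`Complex.affine_of_mapsTo_ball_of_norm_dslope_eq_div` (its equality case), `dslope`,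
`IsCompact.tendsto_nhds_of_unique_mapClusterPt`, `MapClusterPt.tendsto_comp'`, `t2_iff_nhds`,
`Filter.disjoint_nhds_cocompact` (`disjoint_nhds_cocompact`), `tendsto_inv₀_nhdsNE_zero`,
`tendsto_mul_left_cobounded`, `Metric.cobounded_eq_cocompact`,
`tendsto_norm_atTop_iff_cobounded`. From `CaratheodoryHalfPlane` we use `Literature.Probability.RandomPlanarGeometry.cayley`,
`Literature.Probability.RandomPlanarGeometry.cayleyFun`, `Literature.Probability.RandomPlanarGeometry.cayleyInvFun`, `Literature.Probability.RandomPlanarGeometry.tendsto_cayleyFun_cocompact`,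
`Literature.Probability.RandomPlanarGeometry.JordanDomain.tendsto_nhdsWithin_of_extension`, `Literature.Probability.RandomPlanarGeometry.JordanDomain.tendsto_cocompact_of_extension`.

## References

* G. F. Lawler, *Conformally Invariant Processes in the Plane*, AMS (2005), §6.1 (paragraph after
  Remark 6.7: chordal SLE in `D` via `F : D → ℍ` with `F(z) = 0`, `F(w) = ∞`; "any other such
  `F̂` can be written as `r F` for some `r > 0`").
* L. V. Ahlfors, *Complex Analysis*, 3rd ed. (1979), Ch. 3 §3.1 (cross-ratio and linear
  transformations), Ch. 4 §3.4, Thm. 13 (Schwarz's lemma) and the exercises following it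
  (automorphisms of the disc and of the half-plane).
* W. Werner, *Lectures on two-dimensional critical percolation*, IAS/Park City (2007), §3
  (conformal rectangles and their cross-ratio).
* Ch. Pommerenke, *Boundary Behaviour of Conformal Maps* (1992), Thm. 2.6 (Carathéodory).
-/

open Set Filter Topology Complex Metric Bornology
open UpperHalfPlane (upperHalfPlaneSet isOpen_upperHalfPlaneSet)

noncomputable section

namespace Literature.Probability.RandomPlanarGeometry

/-! ### Two filters on the half-plane are non-trivial -/

/-- The filter "`z → ∞` within `ℍₒ`" is non-trivial (the points `(n + 1) i` escape every compact
set inside `ℍₒ`). [folklore] -/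
theorem neBot_cocompact_inf_principal_upperHalfPlaneSet :
    NeBot (cocompact ℂ ⊓ 𝓟 upperHalfPlaneSet) := by
  have ht : Tendsto (fun n : ℕ ↦ ((n + 1 : ℕ) : ℂ) * I) atTop
      (cocompact ℂ ⊓ 𝓟 upperHalfPlaneSet) := by
    refine tendsto_inf.2 ⟨?_, tendsto_principal.2 (Eventually.of_forall fun n ↦ ?_)⟩
    · rw [← cobounded_eq_cocompact, ← tendsto_norm_atTop_iff_cobounded]
      have : (fun n : ℕ ↦ ‖((n + 1 : ℕ) : ℂ) * I‖) = fun n : ℕ ↦ ((n + 1 : ℕ) : ℝ) := by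
        ext n
        rw [norm_mul, norm_I, mul_one, Complex.norm_natCast]
      rw [this]
      exact tendsto_natCast_atTop_atTop.comp (tendsto_add_atTop_nat 1)
    · show (0 : ℝ) < (((n + 1 : ℕ) : ℂ) * I).im
      simp only [mul_im, natCast_re, I_im, mul_one, natCast_im, I_re, mul_zero, add_zero]
      exact_mod_cast Nat.succ_pos n
  exact ht.neBot

/-- The filter "`z → 0` within `ℍₒ`" is non-trivial (`0 ∈ closure ℍₒ`). [folklore] -/
theorem neBot_nhdsWithin_upperHalfPlaneSet_zero : NeBot (𝓝[upperHalfPlaneSet] (0 : ℂ)) :=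
  mem_closure_iff_nhdsWithin_neBot.1 (mem_closure_upperHalfPlaneSet_iff.2 (by simp))

/-- **The inverse Cayley transform has a pole at `1`**: `i(1 + w)/(1 - w) → ∞` as `w → 1`,
`w ≠ 1`. [folklore] -/
theorem tendsto_cayleyInvFun_nhdsNE_one : Tendsto cayleyInvFun (𝓝[≠] 1) (cocompact ℂ) := by
  have h1 : Tendsto (fun w : ℂ ↦ 1 - w) (𝓝[≠] (1 : ℂ)) (𝓝[≠] 0) := by
    refine ((continuous_const.sub continuous_id).tendsto' (1 : ℂ) 0 (by simp)).inf ?_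
    exact tendsto_principal_principal.2 fun w hw ↦ sub_ne_zero.2 (Ne.symm hw)
  have h2 : Tendsto (fun w : ℂ ↦ (1 - w)⁻¹) (𝓝[≠] (1 : ℂ)) (cobounded ℂ) :=
    tendsto_inv₀_nhdsNE_zero.comp h1
  have h3 : Tendsto (fun w : ℂ ↦ 2 * I * (1 - w)⁻¹) (𝓝[≠] (1 : ℂ)) (cocompact ℂ) := by
    rw [← cobounded_eq_cocompact]
    exact (tendsto_mul_left_cobounded (by simp : (2 : ℂ) * I ≠ 0)).comp h2
  have h4 : Tendsto (fun z : ℂ ↦ z + -I) (cocompact ℂ) (cocompact ℂ) :=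
    (Homeomorph.addRight (-I)).toCocompactMap.cocompact_tendsto'
  refine (h4.comp h3).congr' ?_
  filter_upwards [self_mem_nhdsWithin] with w hw
  have hw' : (1 : ℂ) - w ≠ 0 := sub_ne_zero.2 (Ne.symm hw)
  rw [Function.comp_apply, cayleyInvFun_apply]
  field_simp
  ring

namespace ConformalEquiv

/-! ### Automorphisms of the disc fixing the centre -/

/-- **The conformal automorphisms of the unit disc fixing `0` are the rotations**: if
`f : 𝔻 → 𝔻` is a conformal equivalence with `f 0 = 0` then `f z = u z` on `𝔻` for some `|u| = 1`.
Proof: Schwarz's lemma for `f` and for `f⁻¹` gives `|f z| = |z|`, and the equality case of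
Schwarz's lemma (Mathlib `Complex.affine_of_mapsTo_ball_of_norm_dslope_eq_div`) makes `f`
linear. Ahlfors (1979), Ch. 4 §3.4, Thm. 13 and the remark following it. [folklore] -/
theorem exists_eqOn_mul_of_apply_zero (f : ConformalEquiv (ball (0 : ℂ) 1) (ball 0 1))
    (h0 : f 0 = 0) : ∃ u : ℂ, ‖u‖ = 1 ∧ EqOn f (fun z ↦ u * z) (ball 0 1) := by
  have hmaps : MapsTo f (ball (0 : ℂ) 1) (closedBall 0 1) :=
    f.mapsTo.mono_right ball_subset_closedBall
  have hmaps' : MapsTo f.symm (ball (0 : ℂ) 1) (closedBall 0 1) :=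
    f.symm_mapsTo.mono_right ball_subset_closedBall
  have h0' : f.symm 0 = 0 := by
    have := f.symm_apply_apply (x := 0) (by simp)
    rwa [h0] at this
  have hnorm : ∀ z ∈ ball (0 : ℂ) 1, ‖f z‖ = ‖z‖ := by
    intro z hz
    have hz' : ‖z‖ < 1 := mem_ball_zero_iff.1 hz
    refine le_antisymm (Complex.norm_le_norm_of_mapsTo_ball f.differentiableOn_coe hmaps h0 hz') ?_
    have hfz : ‖f z‖ < 1 := mem_ball_zero_iff.1 (f.mapsTo hz)
    have := Complex.norm_le_norm_of_mapsTo_ball f.symm.differentiableOn_coe hmaps' h0' hfz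
    rwa [f.symm_apply_apply hz] at this
  set z₀ : ℂ := 1 / 2 with hz₀
  have hz₀mem : z₀ ∈ ball (0 : ℂ) 1 := by
    rw [mem_ball_zero_iff, hz₀]
    norm_num
  have hz₀ne : z₀ ≠ 0 := by
    rw [hz₀]
    norm_num
  have hslope : ‖dslope f 0 z₀‖ = 1 / 1 := by
    rw [dslope_of_ne _ hz₀ne, slope_def_field, h0, sub_zero, sub_zero, norm_div, hnorm z₀ hz₀mem,
      div_self (norm_ne_zero_iff.2 hz₀ne), div_one]
  have hmapsc : MapsTo f (ball (0 : ℂ) 1) (closedBall (f 0) 1) := by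
    rw [h0]
    exact hmaps
  refine ⟨dslope f 0 z₀, by rw [hslope, div_one], fun z hz ↦ ?_⟩
  have := Complex.affine_of_mapsTo_ball_of_norm_dslope_eq_div f.differentiableOn_coe hmapsc
    hz₀mem hslope hz
  rw [this]
  simp only [h0, zero_add, sub_zero, smul_eq_mul, mul_comm]

/-! ### The normal form of an automorphism of the half-plane -/

/-- **Normal form of the conformal automorphisms of `ℍₒ`**: every conformal equivalence
`M : ℍₒ → ℍₒ` is, on `ℍₒ`, of the form `z ↦ q · C⁻¹(u · C z) + p` with `q > 0`, `p ∈ ℝ`,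
`|u| = 1` and `C` the Cayley transform. Proof: with `M i = p + q i`, the automorphism
`A⁻¹ ∘ M` (`A z = q z + p`) fixes `i`, so its Cayley conjugate is an automorphism of the disc
fixing `0`, hence a rotation (`exists_eqOn_mul_of_apply_zero`). Ahlfors (1979), Ch. 4 §3.4
(exercises after Thm. 13). [folklore] -/
theorem exists_eqOn_normalForm (M : ConformalEquiv upperHalfPlaneSet upperHalfPlaneSet) :
    ∃ (q p : ℝ) (_ : 0 < q) (u : ℂ), ‖u‖ = 1 ∧
      EqOn M (fun z ↦ (q : ℂ) * cayleyInvFun (u * cayleyFun z) + p) upperHalfPlaneSet := by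
  have hI : (I : ℂ) ∈ upperHalfPlaneSet := show (0 : ℝ) < I.im by simp
  set w₀ : ℂ := M I with hw₀
  have hq : 0 < w₀.im := M.mapsTo hI
  -- the real affine automorphism `A z = q z + p` (`q = Im M i`, `p = Re M i`) of `ℍₒ`
  obtain ⟨A, hA⟩ : ∃ A : ConformalEquiv upperHalfPlaneSet upperHalfPlaneSet,
      A = (smulUpperHalfPlane w₀.im hq).trans (addRealUpperHalfPlane w₀.re) := ⟨_, rfl⟩
  have hAapply : ∀ z : ℂ, A z = (w₀.im : ℂ) * z + (w₀.re : ℂ) := fun z ↦ by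
    rw [hA, trans_apply, smulUpperHalfPlane_apply, addRealUpperHalfPlane_apply, real_smul]
  have hAsymm : ∀ z : ℂ, A.symm z = (w₀.im : ℂ)⁻¹ * (z - w₀.re) := fun z ↦ by
    rw [hA, ← ofReal_inv, ← real_smul]
    rfl
  set g : ConformalEquiv (ball (0 : ℂ) 1) (ball 0 1) :=
    cayley.symm.trans ((M.trans A.symm).trans cayley) with hg
  have hAw₀ : A.symm w₀ = I := by
    rw [hAsymm, ← ofReal_inv]
    apply Complex.ext
    · simp
    · simp [hq.ne']
  have hg0 : g 0 = 0 := by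
    rw [hg, trans_apply, trans_apply, trans_apply, cayley_symm_apply, cayley_apply,
      cayleyInvFun_apply]
    have : I * (1 + 0) / (1 - 0) = I := by simp
    rw [this, ← hw₀, hAw₀, cayleyFun_apply, sub_self, zero_div]
  obtain ⟨u, hu, hgu⟩ := g.exists_eqOn_mul_of_apply_zero hg0
  refine ⟨w₀.im, w₀.re, hq, u, hu, fun z hz ↦ ?_⟩
  have hCz : cayleyFun z ∈ ball (0 : ℂ) 1 := cayley.mapsTo hz
  have h1 : g (cayleyFun z) = u * cayleyFun z := hgu hCz
  have h2 : g (cayleyFun z) = cayleyFun (A.symm (M z)) := by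
    rw [hg, trans_apply, trans_apply, trans_apply, cayley_symm_apply, cayley_apply,
      cayleyInvFun_cayleyFun (add_I_ne_zero (le_of_lt hz))]
  have hMz : M z ∈ upperHalfPlaneSet := M.mapsTo hz
  have hAMz : A.symm (M z) ∈ upperHalfPlaneSet := A.symm_mapsTo hMz
  have h3 : A.symm (M z) = cayleyInvFun (u * cayleyFun z) := by
    rw [← h1, h2, cayleyInvFun_cayleyFun (add_I_ne_zero (le_of_lt hAMz))]
  calc M z = A (A.symm (M z)) := (A.apply_symm_apply hMz).symm
    _ = (w₀.im : ℂ) * cayleyInvFun (u * cayleyFun z) + (w₀.re : ℂ) := by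
      rw [h3, hAapply]

/-- The normal form `z ↦ q C⁻¹(u C z) + p` with `u ≠ 1` has the *finite* limit `q C⁻¹(u) + p`
at infinity (`C z → 1`, and `C⁻¹` is continuous away from its pole `1`). [folklore] -/
theorem tendsto_normalForm_cocompact (q p : ℝ) {u : ℂ} (hu : u ≠ 1) :
    Tendsto (fun z ↦ (q : ℂ) * cayleyInvFun (u * cayleyFun z) + p) (cocompact ℂ)
      (𝓝 ((q : ℂ) * cayleyInvFun u + p)) := by
  have h1 : Tendsto (fun z ↦ u * cayleyFun z) (cocompact ℂ) (𝓝 (u * 1)) :=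
    tendsto_cayleyFun_cocompact.const_mul u
  rw [mul_one] at h1
  have h2 : ContinuousAt cayleyInvFun u :=
    differentiableOn_cayleyInvFun.continuousOn.continuousAt (isOpen_ne.mem_nhds hu)
  exact ((h2.tendsto.comp h1).const_mul _).add_const _

/-- **Automorphisms of `ℍₒ` fixing the boundary points `0` and `∞` are dilations**: if
`M : ℍₒ → ℍₒ` is a conformal equivalence with `M z → 0` as `z → 0` and `M z → ∞` as `z → ∞`
(both within `ℍₒ`), then `M z = c z` on `ℍₒ` for some `c > 0`. In the normal form
`q C⁻¹(u C z) + p`, the condition at `∞` forces `u = 1` (otherwise the limit at `∞` is finite),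
so `M z = q z + p`, and the condition at `0` forces `p = 0`. Lawler (2005), §6.1 ("the only
Möbius self-maps of `ℍ` fixing `0` and `∞` are `z ↦ r z`"). [folklore] -/
theorem exists_eqOn_smul_of_tendsto (M : ConformalEquiv upperHalfPlaneSet upperHalfPlaneSet)
    (h0 : Tendsto M (𝓝[upperHalfPlaneSet] 0) (𝓝 0))
    (hinf : Tendsto M (cocompact ℂ ⊓ 𝓟 upperHalfPlaneSet) (cocompact ℂ)) :
    ∃ (c : ℝ) (_ : 0 < c), EqOn M (fun z ↦ (c : ℂ) * z) upperHalfPlaneSet := by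
  obtain ⟨q, p, hq, u, -, hM⟩ := M.exists_eqOn_normalForm
  -- the condition at `∞` forces `u = 1`
  have hu : u = 1 := by
    by_contra hu
    haveI := neBot_cocompact_inf_principal_upperHalfPlaneSet
    have hev : (M : ℂ → ℂ) =ᶠ[cocompact ℂ ⊓ 𝓟 upperHalfPlaneSet]
        fun z ↦ (q : ℂ) * cayleyInvFun (u * cayleyFun z) + p :=
      eventually_inf_principal.2 (Eventually.of_forall hM)
    have h := ((tendsto_normalForm_cocompact q p hu).mono_left inf_le_left).congr' hev.symm
    exact h.not_tendsto (disjoint_nhds_cocompact _) hinf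
  subst hu
  have hM' : EqOn M (fun z ↦ (q : ℂ) * z + p) upperHalfPlaneSet := by
    intro z hz
    rw [hM hz]
    simp only [one_mul]
    rw [cayleyInvFun_cayleyFun (add_I_ne_zero (le_of_lt hz))]
  -- the condition at `0` forces `p = 0`
  have hp : p = 0 := by
    haveI := neBot_nhdsWithin_upperHalfPlaneSet_zero
    have hev : (M : ℂ → ℂ) =ᶠ[𝓝[upperHalfPlaneSet] 0] fun z ↦ (q : ℂ) * z + p :=
      eventually_nhdsWithin_of_forall hM'
    have hcont : Tendsto (fun z : ℂ ↦ (q : ℂ) * z + p) (𝓝[upperHalfPlaneSet] 0)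
        (𝓝 ((q : ℂ) * 0 + p)) :=
      (((continuous_const.mul continuous_id).add continuous_const).tendsto 0).mono_left
        nhdsWithin_le_nhds
    rw [mul_zero, zero_add] at hcont
    have := tendsto_nhds_unique (hcont.congr' hev.symm) h0
    exact_mod_cast this
  subst hp
  refine ⟨q, hq, fun z hz ↦ ?_⟩
  simp only [hM' hz, ofReal_zero, add_zero]

end ConformalEquiv

/-! ### Boundary behaviour of `φ⁻¹` from Carathéodory's theorem -/

/-- **Limits through an injective continuous map on a compact set.** If `Ψ` is continuous and
injective on the compact set `K`, `g` takes values in `K` (eventually along `l`) and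
`Ψ ∘ g → Ψ ζ` with `ζ ∈ K`, then `g → ζ`: every cluster point `x ∈ K` of `g` has `Ψ x = Ψ ζ`.
(This is continuity of `Ψ⁻¹` on `Ψ '' K`, phrased without inverse functions.) [folklore] -/
theorem tendsto_of_injOn_of_tendsto_comp {X Y α : Type*} [TopologicalSpace X]
    [TopologicalSpace Y] [T2Space Y] {Ψ : X → Y} {K : Set X} (hK : IsCompact K)
    (hΨ : ContinuousOn Ψ K) (hinj : InjOn Ψ K) {g : α → X} {l : Filter α}
    (hg : ∀ᶠ a in l, g a ∈ K) {ζ : X} (hζ : ζ ∈ K) (h : Tendsto (Ψ ∘ g) l (𝓝 (Ψ ζ))) :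
    Tendsto g l (𝓝 ζ) := by
  refine hK.tendsto_nhds_of_unique_mapClusterPt hg fun x hx hclust ↦ ?_
  have hle : 𝓝 x ⊓ map g l ≤ 𝓝[K] x :=
    le_inf inf_le_left (inf_le_right.trans (le_principal_iff.2 (mem_map.2 hg)))
  have h1 : MapClusterPt (Ψ x) l (Ψ ∘ g) := hclust.tendsto_comp' ((hΨ x hx).tendsto.mono_left hle)
  have h2 : ClusterPt (Ψ x) (𝓝 (Ψ ζ)) := h1.clusterPt.mono h
  exact hinj hx hζ (t2_iff_nhds.1 ‹T2Space Y› h2)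

namespace JordanDomain

variable {D : JordanDomain} (φ : ConformalEquiv upperHalfPlaneSet D.carrier)

/-- Under a Carathéodory extension `Ψ` of `φ ∘ C⁻¹`, `Ψ (C (φ⁻¹ w)) = w` for `w ∈ D`. [folklore] -/
theorem apply_cayleyFun_symm {Ψ : ℂ → ℂ} (hΨeq : EqOn Ψ (cayley.symm.trans φ) (ball 0 1))
    {w : ℂ} (hw : w ∈ D.carrier) : Ψ (cayleyFun (φ.symm w)) = w := by
  have hw' : φ.symm w ∈ upperHalfPlaneSet := φ.symm_mapsTo hw
  have hC : cayleyFun (φ.symm w) ∈ ball (0 : ℂ) 1 := cayley.mapsTo hw'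
  rw [hΨeq hC, ConformalEquiv.trans_apply, cayley_symm_apply,
    cayleyInvFun_cayleyFun (add_I_ne_zero (le_of_lt hw')), φ.apply_symm_apply hw]

/-- **Boundary behaviour of `φ⁻¹` from Carathéodory's theorem.** If `Ψ` is a continuous
injective extension of `φ ∘ C⁻¹` to the closed unit disc (as provided by
`JordanDomain.exists_continuousOn_extension`), then for every `ζ` of the closed disc,
`C (φ⁻¹ w) → ζ` as `w → Ψ ζ` within `D`. Pommerenke (1992), Thm. 2.6. [folklore] -/
theorem tendsto_cayleyFun_symm {Ψ : ℂ → ℂ} (hΨc : ContinuousOn Ψ (closedBall 0 1))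
    (hΨeq : EqOn Ψ (cayley.symm.trans φ) (ball 0 1)) (hinj : InjOn Ψ (closedBall 0 1))
    {ζ : ℂ} (hζ : ζ ∈ closedBall (0 : ℂ) 1) :
    Tendsto (fun w ↦ cayleyFun (φ.symm w)) (𝓝[D.carrier] (Ψ ζ)) (𝓝 ζ) := by
  have hg : ∀ᶠ w in 𝓝[D.carrier] (Ψ ζ), cayleyFun (φ.symm w) ∈ closedBall (0 : ℂ) 1 := by
    filter_upwards [self_mem_nhdsWithin] with w hw
    exact ball_subset_closedBall (cayley.mapsTo (φ.symm_mapsTo hw))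
  refine tendsto_of_injOn_of_tendsto_comp (isCompact_closedBall 0 1) hΨc hinj hg hζ ?_
  have hev : (Ψ ∘ fun w ↦ cayleyFun (φ.symm w)) =ᶠ[𝓝[D.carrier] (Ψ ζ)] id := by
    filter_upwards [self_mem_nhdsWithin] with w hw
    exact apply_cayleyFun_symm φ hΨeq hw
  exact (tendsto_id.mono_left nhdsWithin_le_nhds).congr' hev.symm

/-- The Carathéodory extension takes the value of the boundary limit: if `φ → p` at infinity
within `ℍₒ` then `Ψ 1 = p`. [folklore] -/
theorem extension_one_eq {Ψ : ℂ → ℂ} (hΨc : ContinuousOn Ψ (closedBall 0 1))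
    (hΨeq : EqOn Ψ (cayley.symm.trans φ) (ball 0 1)) {p : ℂ} (hp : φ.HasBoundaryValueAtInfty p) :
    Ψ 1 = p :=
  haveI := neBot_cocompact_inf_principal_upperHalfPlaneSet
  tendsto_nhds_unique (tendsto_cocompact_of_extension φ hΨc hΨeq) hp

/-- The Carathéodory extension takes the value of the boundary limit: if `φ → p` at the real
point `x` within `ℍₒ` then `Ψ (C x) = p`. [folklore] -/
theorem extension_cayleyFun_eq {Ψ : ℂ → ℂ} (hΨc : ContinuousOn Ψ (closedBall 0 1))
    (hΨeq : EqOn Ψ (cayley.symm.trans φ) (ball 0 1)) {x : ℝ} {p : ℂ}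
    (hp : φ.HasBoundaryValue x p) : Ψ (cayleyFun x) = p :=
  haveI : NeBot (𝓝[upperHalfPlaneSet] (x : ℂ)) :=
    mem_closure_iff_nhdsWithin_neBot.1 (mem_closure_upperHalfPlaneSet_iff.2 (by simp))
  tendsto_nhds_unique (tendsto_nhdsWithin_of_extension φ hΨc hΨeq (x := x) (by simp)) hp

/-- **`φ⁻¹ → ∞` at the boundary value at infinity.** If `φ → b` at infinity within `ℍₒ`, then
`φ⁻¹ w → ∞` as `w → b` within `D` (given a Carathéodory extension). Pommerenke (1992),
Thm. 2.6. [folklore] -/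
theorem tendsto_symm_cocompact {Ψ : ℂ → ℂ} (hΨc : ContinuousOn Ψ (closedBall 0 1))
    (hΨeq : EqOn Ψ (cayley.symm.trans φ) (ball 0 1)) (hinj : InjOn Ψ (closedBall 0 1))
    {b : ℂ} (hb : φ.HasBoundaryValueAtInfty b) :
    Tendsto φ.symm (𝓝[D.carrier] b) (cocompact ℂ) := by
  have h1 : Tendsto (fun w ↦ cayleyFun (φ.symm w)) (𝓝[D.carrier] b) (𝓝[≠] 1) := by
    refine tendsto_nhdsWithin_iff.2 ⟨?_, ?_⟩
    · rw [← extension_one_eq φ hΨc hΨeq hb]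
      exact tendsto_cayleyFun_symm φ hΨc hΨeq hinj (by simp)
    · filter_upwards [self_mem_nhdsWithin] with w hw
      have : ‖cayleyFun (φ.symm w)‖ < 1 := mem_ball_zero_iff.1 (cayley.mapsTo (φ.symm_mapsTo hw))
      rintro (h : cayleyFun (φ.symm w) = 1)
      rw [h] at this
      simp at this
  refine (tendsto_cayleyInvFun_nhdsNE_one.comp h1).congr' ?_
  filter_upwards [self_mem_nhdsWithin] with w hw
  exact cayleyInvFun_cayleyFun (add_I_ne_zero (le_of_lt (φ.symm_mapsTo hw)))

/-- **`φ⁻¹ → x` at the boundary value at a real point.** If `φ → a` at the real point `x`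
within `ℍₒ`, then `φ⁻¹ w → x` as `w → a` within `D` (given a Carathéodory extension).
Pommerenke (1992), Thm. 2.6. [folklore] -/
theorem tendsto_symm_nhds {Ψ : ℂ → ℂ} (hΨc : ContinuousOn Ψ (closedBall 0 1))
    (hΨeq : EqOn Ψ (cayley.symm.trans φ) (ball 0 1)) (hinj : InjOn Ψ (closedBall 0 1))
    {x : ℝ} {a : ℂ} (ha : φ.HasBoundaryValue x a) :
    Tendsto φ.symm (𝓝[D.carrier] a) (𝓝 x) := by
  have hx : (x : ℂ) + I ≠ 0 := add_I_ne_zero (by simp)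
  have h1 : Tendsto (fun w ↦ cayleyFun (φ.symm w)) (𝓝[D.carrier] a) (𝓝 (cayleyFun x)) := by
    rw [← extension_cayleyFun_eq φ hΨc hΨeq ha]
    exact tendsto_cayleyFun_symm φ hΨc hΨeq hinj
      (mem_closedBall_zero_iff.2 (norm_cayleyFun_ofReal x).le)
  have h2 : ContinuousAt cayleyInvFun (cayleyFun x) := by
    refine differentiableOn_cayleyInvFun.continuousOn.continuousAt (isOpen_ne.mem_nhds ?_)
    intro h
    have := norm_cayleyFun_lt_one_iff hx
    have h1' : cayleyInvFun (cayleyFun x) = x := cayleyInvFun_cayleyFun hx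
    rw [h, cayleyInvFun_apply, sub_self, div_zero] at h1'
    have := congrArg Complex.re h1'
    simp only [zero_re, ofReal_re] at this
    -- `x = 0` would give `cayleyFun 0 = -1 ≠ 1`
    rw [← this, ofReal_zero, cayleyFun_apply, zero_sub, zero_add, neg_div, div_self I_ne_zero]
      at h
    norm_num at h
  have h3 := h2.tendsto.comp h1
  rw [cayleyInvFun_cayleyFun hx] at h3
  refine h3.congr' ?_
  filter_upwards [self_mem_nhdsWithin] with w hw
  exact cayleyInvFun_cayleyFun (add_I_ne_zero (le_of_lt (φ.symm_mapsTo hw)))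

end JordanDomain

/-! ### Uniqueness of chordal uniformizing maps up to dilation -/

namespace MarkedDomain

/-- **Uniqueness of chordal uniformizing maps up to dilation, from Carathéodory's theorem
(disc form).** Given Pommerenke's Thm. 2.6 as vendored in
`JordanDomain.exists_continuousOn_extension`, two chordal uniformizing maps `φ, φ'` of a
Dobrushin domain `(D; a, b)` satisfy `φ' = φ ∘ (z ↦ c z)` on `ℍₒ` for some `c > 0`: the
automorphism `M = φ⁻¹ ∘ φ'` of `ℍₒ` tends to `0` at `0` and to `∞` at `∞`
(`JordanDomain.tendsto_symm_nhds`, `JordanDomain.tendsto_symm_cocompact`), hence is a dilation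
(`ConformalEquiv.exists_eqOn_smul_of_tendsto`). This discharges the named fact
`IsChordalUniformizing.exists_eq_trans_smul` relative to Carathéodory's theorem.
Lawler (2005), §6.1 (paragraph after Remark 6.7). [cite: Lawler2005, §6.1] -/
theorem IsChordalUniformizing.exists_eq_trans_smul_of_disc
    (h : JordanDomain.exists_continuousOn_extension) :
    IsChordalUniformizing.exists_eq_trans_smul := by
  intro D φ φ' hφ hφ'
  obtain ⟨Ψ, hΨc, hΨeq, hbij, -⟩ := h D.toJordanDomain (cayley.symm.trans φ)
  have hinj : InjOn Ψ (closedBall 0 1) := hbij.injOn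
  set M : ConformalEquiv upperHalfPlaneSet upperHalfPlaneSet := φ'.trans φ.symm with hM
  have hMapply : ∀ z, M z = φ.symm (φ' z) := fun z ↦ rfl
  have h0 : Tendsto M (𝓝[upperHalfPlaneSet] 0) (𝓝 0) := by
    have h1 : Tendsto φ' (𝓝[upperHalfPlaneSet] 0) (𝓝[D.carrier] (D.pt 0)) :=
      tendsto_nhdsWithin_iff.2 ⟨hφ'.1, eventually_nhdsWithin_of_forall fun z hz ↦ φ'.mapsTo hz⟩
    have h2 := JordanDomain.tendsto_symm_nhds φ hΨc hΨeq hinj (x := 0)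
      (a := D.pt 0) (by exact_mod_cast hφ.1)
    have := h2.comp h1
    rwa [ofReal_zero] at this
  have hinf : Tendsto M (cocompact ℂ ⊓ 𝓟 upperHalfPlaneSet) (cocompact ℂ) := by
    have h1 : Tendsto φ' (cocompact ℂ ⊓ 𝓟 upperHalfPlaneSet) (𝓝[D.carrier] (D.pt 1)) :=
      tendsto_nhdsWithin_iff.2 ⟨hφ'.2,
        eventually_inf_principal.2 (Eventually.of_forall fun z hz ↦ φ'.mapsTo hz)⟩
    exact (JordanDomain.tendsto_symm_cocompact φ hΨc hΨeq hinj hφ.2).comp h1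
  obtain ⟨c, hc, hMc⟩ := M.exists_eqOn_smul_of_tendsto h0 hinf
  refine ⟨c, hc, fun z hz ↦ ?_⟩
  have hMz : M z = (c : ℂ) * z := hMc hz
  rw [ConformalEquiv.trans_apply, ConformalEquiv.smulUpperHalfPlane_apply, real_smul, ← hMz,
    hMapply]
  exact (φ.apply_symm_apply (φ'.mapsTo hz)).symm

end MarkedDomain

/-! ### The boundary correspondence from Carathéodory's theorem -/

namespace JordanDomain

/-- **Carathéodory, half-plane form, from the disc form: the boundary correspondence.** Every
boundary point `p ∈ ∂D` is the boundary value of `φ : ℍₒ → D` at infinity or at exactly one real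
point (`JordanDomain.existsUnique_real_or_infty`), from `JordanDomain.exists_continuousOn_extension`
(Pommerenke (1992), Thm. 2.6): `p = Ψ ζ` for a unique `ζ` on the unit circle; `ζ = 1` is the
value at infinity, otherwise `ζ = C x` for the real `x = C⁻¹ ζ`, and a second real point `x'`
with value `p` would give `Ψ (C x') = p = Ψ (C x)` (`extension_cayleyFun_eq`), so `x' = x` by
injectivity of `Ψ` on the closed disc and of `C`. [cite: PommerenkeBBCM1992, Thm. 2.6] -/
theorem existsUnique_real_or_infty_of_disc (h : exists_continuousOn_extension) :
    existsUnique_real_or_infty := by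
  intro D φ p hp
  obtain ⟨Ψ, hΨc, hΨeq, hbij, hsph⟩ := h D (cayley.symm.trans φ)
  obtain ⟨ζ, hζ, rfl⟩ := hsph.surjOn hp
  rw [mem_sphere_zero_iff_norm] at hζ
  by_cases hζ1 : ζ = 1
  · subst hζ1
    exact Or.inr (tendsto_cocompact_of_extension φ hΨc hΨeq)
  refine Or.inl ⟨(cayleyInvFun ζ).re, ?_, fun x' hx' ↦ ?_⟩
  · have hcx : cayleyFun ((cayleyInvFun ζ).re : ℂ) = ζ := by
      rw [← cayleyInvFun_eq_ofReal_re hζ, cayleyFun_cayleyInvFun hζ1]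
    have := tendsto_nhdsWithin_of_extension φ hΨc hΨeq (x := ((cayleyInvFun ζ).re : ℂ)) (by simp)
    rwa [hcx] at this
  · have h1 : Ψ (cayleyFun x') = Ψ ζ := extension_cayleyFun_eq φ hΨc hΨeq hx'
    have h2 : cayleyFun x' = ζ :=
      hbij.injOn (mem_closedBall_zero_iff.2 (norm_cayleyFun_ofReal x').le)
        (mem_closedBall_zero_iff.2 hζ.le) h1
    have h3 : cayleyInvFun (cayleyFun x') = x' := cayleyInvFun_cayleyFun (add_I_ne_zero (by simp))
    rw [h2] at h3
    have := congrArg Complex.re h3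
    simpa using this.symm

end JordanDomain

/-! ### Conformal invariance of Cardy's cross-ratio -/

/-- The **complex cross-ratio** `(z₀ - z₁)(z₂ - z₃) / ((z₀ - z₂)(z₁ - z₃))` of four complex
numbers, with the same convention (and junk value `0` on a vanishing denominator) as the real
`Literature.Probability.RandomPlanarGeometry.crossRatio`. Ahlfors (1979), Ch. 3 §3.1. [folklore] -/
def cCrossRatio (z : Fin 4 → ℂ) : ℂ :=
  (z 0 - z 1) * (z 2 - z 3) / ((z 0 - z 2) * (z 1 - z 3))

/-- The complex cross-ratio of four real points is Cardy's real cross-ratio. [folklore] -/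
theorem cCrossRatio_ofReal (x : Fin 4 → ℝ) :
    cCrossRatio (fun i ↦ (x i : ℂ)) = (crossRatio x : ℂ) := by
  simp only [cCrossRatio, crossRatio]
  push_cast
  rfl

/-- **The cross-ratio is invariant under Möbius transformations** `z ↦ (a z + b)/(c z + d)`,
`a d - b c ≠ 0`, at four points off the pole. Ahlfors (1979), Ch. 3 §3.1. [folklore] -/
theorem cCrossRatio_moebius (z : Fin 4 → ℂ) {a b c d : ℂ} (hdet : a * d - b * c ≠ 0)
    (hz : ∀ i, c * z i + d ≠ 0) :
    cCrossRatio (fun i ↦ (a * z i + b) / (c * z i + d)) = cCrossRatio z := by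
  have key : ∀ i j, (a * z i + b) / (c * z i + d) - (a * z j + b) / (c * z j + d) =
      (a * d - b * c) * (z i - z j) / ((c * z i + d) * (c * z j + d)) := by
    intro i j
    rw [div_sub_div _ _ (hz i) (hz j)]
    congr 1
    ring
  simp only [cCrossRatio]
  rw [key 0 1, key 2 3, key 0 2, key 1 3, div_mul_div_comm, div_mul_div_comm, div_div_div_eq]
  set D := a * d - b * c
  set P := (c * z 0 + d) * (c * z 1 + d) * (c * z 2 + d) * (c * z 3 + d) with hP
  have hP0 : D ^ 2 * P ≠ 0 :=
    mul_ne_zero (pow_ne_zero 2 hdet) (mul_ne_zero (mul_ne_zero (mul_ne_zero (hz 0) (hz 1)) (hz 2)) (hz 3))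
  have hn : D * (z 0 - z 1) * (D * (z 2 - z 3)) * ((c * z 0 + d) * (c * z 2 + d) *
      ((c * z 1 + d) * (c * z 3 + d))) = D ^ 2 * P * ((z 0 - z 1) * (z 2 - z 3)) := by
    rw [hP]; ring
  have hd : (c * z 0 + d) * (c * z 1 + d) * ((c * z 2 + d) * (c * z 3 + d)) *
      (D * (z 0 - z 2) * (D * (z 1 - z 3))) = D ^ 2 * P * ((z 0 - z 2) * (z 1 - z 3)) := by
    rw [hP]; ring
  rw [hn, hd, mul_div_mul_left _ _ hP0]

/-- **The Cayley conjugate of a rotation is a Möbius map**: for `u C z ≠ 1`,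
`C⁻¹(u · C z) = (i(1 + u) z - (1 - u)) / ((1 - u) z + i(1 + u))`. [folklore] -/
theorem cayleyInvFun_mul_cayleyFun {u z : ℂ} (hz : z + I ≠ 0) (h1 : u * cayleyFun z ≠ 1) :
    cayleyInvFun (u * cayleyFun z) =
      (I * (1 + u) * z + -(1 - u)) / ((1 - u) * z + I * (1 + u)) := by
  have hden : (1 - u) * z + I * (1 + u) ≠ 0 := by
    intro h
    apply h1
    rw [cayleyFun_apply, mul_div_assoc', div_eq_one_iff_eq hz]
    linear_combination -h
  have h1' : 1 - u * ((z - I) / (z + I)) ≠ 0 := by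
    intro h
    exact h1 (by rw [cayleyFun_apply]; linear_combination -h)
  rw [cayleyInvFun_apply, cayleyFun_apply, div_eq_div_iff h1' hden]
  field_simp
  linear_combination (z + z * u ^ 2 - 2 * z * u + I - I * u ^ 2) * I_sq

/-- The determinant of that Möbius map is `-4u ≠ 0`. [folklore] -/
theorem det_cayley_conj (u : ℂ) :
    I * (1 + u) * (I * (1 + u)) - -(1 - u) * (1 - u) = -4 * u := by
  ring_nf
  rw [I_sq]
  ring

namespace ConformalEquiv

/-- **Boundary values of the normal form at real points.** If `M = q C⁻¹(u C ·) + p` on `ℍₒ`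
has a *finite* limit `y` at the real point `x₀` within `ℍₒ`, then `x₀` is not the pole
(`u C x₀ ≠ 1`) and `y` is the value of the formula at `x₀` (at the pole the normal form tends to
`∞`, by `tendsto_cayleyInvFun_nhdsNE_one`). [folklore] -/
theorem normalForm_boundaryValue {M : ℂ → ℂ} {q p : ℝ} (hq : 0 < q) {u : ℂ} (hu : ‖u‖ = 1)
    (hM : EqOn M (fun z ↦ (q : ℂ) * cayleyInvFun (u * cayleyFun z) + p) upperHalfPlaneSet)
    {x₀ : ℝ} {y : ℂ} (h : Tendsto M (𝓝[upperHalfPlaneSet] x₀) (𝓝 y)) :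
    u * cayleyFun x₀ ≠ 1 ∧ y = (q : ℂ) * cayleyInvFun (u * cayleyFun x₀) + p := by
  have hx₀ : (x₀ : ℂ) + I ≠ 0 := add_I_ne_zero (by simp)
  haveI : NeBot (𝓝[upperHalfPlaneSet] (x₀ : ℂ)) :=
    mem_closure_iff_nhdsWithin_neBot.1 (mem_closure_upperHalfPlaneSet_iff.2 (by simp))
  have hev : M =ᶠ[𝓝[upperHalfPlaneSet] (x₀ : ℂ)]
      fun z ↦ (q : ℂ) * cayleyInvFun (u * cayleyFun z) + p :=
    eventually_nhdsWithin_of_forall hM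
  have hC : ContinuousAt cayleyFun (x₀ : ℂ) :=
    continuousOn_cayleyFun.continuousAt
      ((isOpen_ne_fun (continuous_id.add continuous_const) continuous_const).mem_nhds hx₀)
  have huC : Tendsto (fun z ↦ u * cayleyFun z) (𝓝[upperHalfPlaneSet] (x₀ : ℂ))
      (𝓝 (u * cayleyFun x₀)) :=
    (hC.tendsto.mono_left nhdsWithin_le_nhds).const_mul u
  by_cases h1 : u * cayleyFun x₀ = 1
  · -- at the pole the normal form escapes to infinity: contradiction with the finite limit
    exfalso
    have huC' : Tendsto (fun z ↦ u * cayleyFun z) (𝓝[upperHalfPlaneSet] (x₀ : ℂ)) (𝓝[≠] 1) := by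
      refine tendsto_nhdsWithin_iff.2 ⟨h1 ▸ huC, ?_⟩
      filter_upwards [self_mem_nhdsWithin] with z hz
      have hlt : ‖u * cayleyFun z‖ < 1 := by
        rw [norm_mul, hu, one_mul]
        exact mem_ball_zero_iff.1 (cayley.mapsTo hz)
      intro (h : u * cayleyFun z = 1)
      rw [h, norm_one] at hlt
      exact lt_irrefl _ hlt
    have h2 : Tendsto (fun z ↦ cayleyInvFun (u * cayleyFun z)) (𝓝[upperHalfPlaneSet] (x₀ : ℂ))
        (cocompact ℂ) :=
      tendsto_cayleyInvFun_nhdsNE_one.comp huC'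
    have h3 : Tendsto (fun w : ℂ ↦ (q : ℂ) * w + p) (cocompact ℂ) (cocompact ℂ) := by
      have hs : Tendsto (fun w : ℂ ↦ q • w) (cocompact ℂ) (cocompact ℂ) :=
        (Homeomorph.smulOfNeZero q hq.ne' : ℂ ≃ₜ ℂ).map_cocompact.le
      have ha : Tendsto (fun w : ℂ ↦ w + (p : ℂ)) (cocompact ℂ) (cocompact ℂ) :=
        (Homeomorph.addRight (p : ℂ)).toCocompactMap.cocompact_tendsto'
      simpa [Function.comp_def, Complex.real_smul] using ha.comp hs
    have h4 := (h3.comp h2).congr' (hev.symm.mono fun z hz ↦ by simpa using hz)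
    exact h4.not_tendsto (disjoint_nhds_cocompact y).symm h
  · refine ⟨h1, ?_⟩
    have hCi : ContinuousAt cayleyInvFun (u * cayleyFun x₀) :=
      differentiableOn_cayleyInvFun.continuousOn.continuousAt (isOpen_ne.mem_nhds h1)
    have hN : Tendsto (fun z ↦ (q : ℂ) * cayleyInvFun (u * cayleyFun z) + p)
        (𝓝[upperHalfPlaneSet] (x₀ : ℂ)) (𝓝 ((q : ℂ) * cayleyInvFun (u * cayleyFun x₀) + p)) :=
      ((hCi.tendsto.comp huC).const_mul _).add_const _
    exact tendsto_nhds_unique h (hN.congr' hev.symm)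

end ConformalEquiv

namespace ConformalRectangle

/-- **Conformal invariance of Cardy's cross-ratio, from Carathéodory's theorem (disc form).**
Two uniformizing data `(φ, x)`, `(φ', x')` of a conformal rectangle have the same cross-ratio
(`ConformalRectangle.crossRatio_eq_of_isUniformizing`): the automorphism `M = φ⁻¹ ∘ φ'` of `ℍₒ`
has boundary value `x i` at `x' i` (`JordanDomain.tendsto_symm_nhds`), is a real Möbius map in
normal form (`ConformalEquiv.exists_eqOn_normalForm`, `normalForm_boundaryValue`,
`cayleyInvFun_mul_cayleyFun`), and Möbius maps preserve cross-ratios (`cCrossRatio_moebius`).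
Ahlfors (1979), Ch. 3 §3.1 and Ch. 6 §1.1; Werner (2007), §3. [cite: AhlforsCA1979, Ch. 3 §3.1] -/
theorem crossRatio_eq_of_isUniformizing_of_disc (hC : JordanDomain.exists_continuousOn_extension) :
    crossRatio_eq_of_isUniformizing := by
  intro R φ φ' x x' hφ hφ'
  obtain ⟨Ψ, hΨc, hΨeq, hbij, -⟩ := hC R.toJordanDomain (cayley.symm.trans φ)
  set M : ConformalEquiv upperHalfPlaneSet upperHalfPlaneSet := φ'.trans φ.symm with hM
  have hlim : ∀ i, Tendsto M (𝓝[upperHalfPlaneSet] (x' i)) (𝓝 (x i)) := fun i ↦ by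
    have h1 : Tendsto φ' (𝓝[upperHalfPlaneSet] (x' i)) (𝓝[R.carrier] (R.pt i)) :=
      tendsto_nhdsWithin_iff.2 ⟨hφ'.2 i, eventually_nhdsWithin_of_forall fun z hz ↦ φ'.mapsTo hz⟩
    exact (JordanDomain.tendsto_symm_nhds φ hΨc hΨeq hbij.injOn (hφ.2 i)).comp h1
  obtain ⟨q, p, hq, u, hu, hMn⟩ := M.exists_eqOn_normalForm
  have hb := fun i ↦ ConformalEquiv.normalForm_boundaryValue hq hu hMn (hlim i)
  have hu0 : u ≠ 0 := norm_ne_zero_iff.1 (by rw [hu]; exact one_ne_zero)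
  -- the four boundary points `x i` are the Möbius images of the `x' i`
  set α : ℂ := I * (1 + u)
  set β : ℂ := -(1 - u)
  set γ : ℂ := 1 - u
  set δ : ℂ := I * (1 + u)
  have hpole : ∀ i, γ * (x' i : ℂ) + δ ≠ 0 := fun i h ↦ (hb i).1 <| by
    rw [cayleyFun_apply, mul_div_assoc', div_eq_one_iff_eq (add_I_ne_zero (by simp))]
    linear_combination -h
  have hx : (fun i ↦ (x i : ℂ)) =
      fun i ↦ ((q : ℂ) * ((α * x' i + β) / (γ * x' i + δ)) + p) / (0 * ((α * x' i + β) /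
        (γ * x' i + δ)) + 1) := by
    funext i
    rw [zero_mul, zero_add, div_one, (hb i).2,
      cayleyInvFun_mul_cayleyFun (add_I_ne_zero (by simp)) (hb i).1]
  have key : (crossRatio x : ℂ) = crossRatio x' := by
    rw [← cCrossRatio_ofReal, ← cCrossRatio_ofReal, hx,
      cCrossRatio_moebius _ (by simpa using (ofReal_ne_zero.2 hq.ne')) (by simp),
      cCrossRatio_moebius _ (by rw [det_cayley_conj]; exact mul_ne_zero (by norm_num) hu0) hpole]
  exact_mod_cast key

end ConformalRectangle

end Literature.Probability.RandomPlanarGeometry
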